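import Summits.Ventures.YMGap.RobustBall.MassGapOnBall
import Summits.Ventures.YMGap.RobustBall.MassGapOfDoorKR
import Summits.Ventures.YMGap.Thresholds.OneLinkEigenModulus
import HarnessLib

/-!
# Venture YMGap, track Y2 ROBUST-BALL — the ALL-`N` rows of the `ℤ^d` single-link ball theorems (hypothesis-free):
# Bakry–Émery pair door and eigen/Bakry–Émery Kantorovich–Rubinstein door, every `N ≥ 2`, every `d ≥ 1`

HONEST FRAMING.  Venture file of the cell `pub-ymgap` (QuantumFields programme), seat p2 (g7).  Strong-coupling LATTICE
statements only (`SU(N)` lattice Yang–Mills on `ℤ^d` at 't Hooft coupling `β`, tree coupling `N β`, plus a link perturbation in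
the tier-1 ball); nothing about the continuum, weak coupling, or the Clay problem.  Kernel ARITHMETIC over tree theorems, nothing
else; no certificate, no named hypothesis.  PURPOSE: rb-theory's status sheet `HOME/rb/K1-STATUS.md` lists «`N ≥ 3` rows on the
ball» as a to-do (certified rows exist for `SU(2)`, and for `SU(3)` on the cell's certificates); this file supplies the GENERIC
all-`N` rows from the tree's hypothesis-free one-link inputs, so that every currency of the Y2 table has an «every `N`» line.

CONTENT.
* `suN_massGapOnBallZd_bakryEmery` — PAIR DOOR (rb-p1's `massGapOnBallZd_of_pair`, Holley–Stroock route, no self-Lipschitz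
  load) fed with the all-`N` Bakry–Émery pair `(c, v) = (1/(N(1/2−b)), N/(1/2−b))` (`oneLinkPoincareSUN_bakryEmery`,
  `oneLinkVarianceBound_bakryEmery`), `b = 2(d−1)|β| < 1/2`, `√(c v) = 1/(1/2 − b)`, `√c = 1/√(N(1/2−b))`:
    `6(d−1)|β| e^{ε₀}/(1/2 − b) + e^{ε₀/2} ε₁/√(N(1/2 − b)) < 1 ⇒ MassGapOnBallZd d N β ε₀ ε₁ R`   (every `N ≥ 2`, `d ≥ 1`).
  Zero loads: the Shen–Zhu–Zhu window `|β| < 1/(16(d−1))` (`d = 4`: `1/48`).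
* `suN_perturbedMassGapAt_eigen` — KR DOOR (ds-4's `perturbedMassGapAt_of_oneLinkKRModulus`) fed with the tree's best all-`N`
  analytic modulus `min(1/(1/2−b), (N²/(N²−1))(1/2+2b)/(1/2−b))` (`OneLinkEigen.oneLinkKRModulus_min`), loads `(a, ℓ_s, Λ)`:
    `6(d−1)|β|·K·e^{a}(1 + 2√N ℓ_s) + √N Λ < 1 ⇒ PerturbedMassGapAt d N β W supp`.
  Zero loads, `d = 4`: `18x·min(K_BE, K₁)(6x) < 1`, i.e. 't Hooft `x < 0.0246…` for large `N` (Bakry–Émery alone: `1/48 = 0.0208`).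
* `suN_massGapOnBallZd_bakryEmery_dim4_row`: the `d = 4` numeric instance `(β, ε₀, ε₁) = (1/64, 1/10, 1/10)`, every `N ≥ 2`
  (exact rationals: `e^{1/10} ≤ 1.1052`, `e^{1/20} ≤ 1.0513`, `1/√(N·13/32) ≤ 1` for `N ≥ 3`, checked separately at `N = 2`).
NOT CLAIMED: anything for the star door or the slab door; any optimality; rows for specific small `N` are better served by the
certified `SU(2)`/`SU(3)` files (`RowsSU2`, `RowsSU3Certified`).
-/

noncomputable section

open MeasureTheory ProbabilityTheory Real
open Literature.Probability.LatticeModels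
open Literature.Probability.LatticeModels.DobrushinMetric
open Literature.MathematicalPhysics.QuantumLattice
open Literature.MathematicalPhysics.QuantumFieldTheory hiding ZdEdge
open Literature.MathematicalPhysics.QuantumFieldTheory.Balaban1983to89.StrongCouplingDobrushinWindow (OneLinkKRModulus)
open Summit.QuantumFields.BalabanUV.InfraRed.StrongCouplingPoincareDoorSUN (OneLinkPoincareSUN oneLinkPoincareSUN_bakryEmery)
open Summit.QuantumFields.BalabanUV.InfraRed.StrongCouplingVarianceDoorSUN (OneLinkVarianceBound oneLinkVarianceBound_bakryEmery)
open Summit.Ventures.YMGap.RobustBall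

namespace Summit.Ventures.YMGap.RobustBallSUN

variable {d N : ℕ}

/-! ### 1. The pair door with the all-`N` Bakry–Émery pair -/

/-- **ALL `N ≥ 2`, EVERY `d ≥ 1` — MASS GAP ON THE `ℤ^d` BALL from the Bakry–Émery one-link pair.**  With `b = 2(d−1)|β| < 1/2`:
`6(d−1)|β| e^{ε₀}/(1/2 − b) + e^{ε₀/2} ε₁ /√(N(1/2 − b)) < 1 ⇒ MassGapOnBallZd d N β ε₀ ε₁ R` — every member of the tier-1 ball
(oscillation load `≤ ε₀`, cross-Lipschitz load `≤ ε₁`, range `R`) around the `SU(N)` Wilson action at 't Hooft coupling `β` has a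
unique, exponentially clustering DLR state.  Hypothesis-free (tree: `massGapOnBallZd_of_pair`, `oneLinkPoincareSUN_bakryEmery`,
`oneLinkVarianceBound_bakryEmery`). [folklore] -/
theorem suN_massGapOnBallZd_bakryEmery (hd : 1 ≤ d) (hN : 2 ≤ N) {β ε₀ ε₁ : ℝ} (R : ℝ)
    (hb : |β| * (2 * ((d : ℝ) - 1)) < 1 / 2)
    (hρ : 6 * ((d : ℝ) - 1) * |β| * exp ε₀ / (1 / 2 - |β| * (2 * ((d : ℝ) - 1)))
      + exp (ε₀ / 2) * ε₁ / Real.sqrt ((N : ℝ) * (1 / 2 - |β| * (2 * ((d : ℝ) - 1)))) < 1) :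
    MassGapOnBallZd d N β ε₀ ε₁ R := by
  set b : ℝ := |β| * (2 * ((d : ℝ) - 1)) with hbdef
  have hNpos : (0 : ℝ) < N := by exact_mod_cast (show 0 < N by omega)
  have hgap : 0 < 1 / 2 - b := by linarith
  have hP := oneLinkPoincareSUN_bakryEmery hN hb
  have hV := oneLinkVarianceBound_bakryEmery hN hb
  have hc : (0 : ℝ) ≤ 1 / ((N : ℝ) * (1 / 2 - b)) := by positivity
  have hv : (0 : ℝ) ≤ (N : ℝ) / (1 / 2 - b) := by positivity
  refine massGapOnBallZd_of_pair d N hd (by omega) R hc hv le_rfl (fun B hB => hP B hB) (fun B hB => hV B hB) ?_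
  have hsq1 : Real.sqrt (1 / ((N : ℝ) * (1 / 2 - b)) * ((N : ℝ) / (1 / 2 - b))) = 1 / (1 / 2 - b) := by
    rw [show 1 / ((N : ℝ) * (1 / 2 - b)) * ((N : ℝ) / (1 / 2 - b)) = (1 / (1 / 2 - b)) ^ 2 by field_simp,
      Real.sqrt_sq (by positivity)]
  have hsq2 : Real.sqrt (1 / ((N : ℝ) * (1 / 2 - b))) = 1 / Real.sqrt ((N : ℝ) * (1 / 2 - b)) := by
    rw [Real.sqrt_div' _ (mul_nonneg hNpos.le hgap.le), Real.sqrt_one]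
  rw [hsq1, hsq2]
  calc 6 * ((d : ℝ) - 1) * |β| * (exp ε₀ * (1 / (1 / 2 - b))) + exp (ε₀ / 2) * (1 / Real.sqrt ((N : ℝ) * (1 / 2 - b))) * ε₁
      = 6 * ((d : ℝ) - 1) * |β| * exp ε₀ / (1 / 2 - b) + exp (ε₀ / 2) * ε₁ / Real.sqrt ((N : ℝ) * (1 / 2 - b)) := by ring
    _ < 1 := hρ

/-- The `d = 4` reading: `b = 6|β|`, `18|β| e^{ε₀}/(1/2 − 6|β|) + e^{ε₀/2} ε₁/√(N(1/2 − 6|β|)) < 1 ⇒ MassGapOnBallZd 4 N β ε₀ ε₁ R`,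
every `N ≥ 2`. [folklore] -/
theorem suN_massGapOnBallZd_bakryEmery_dim4 (hN : 2 ≤ N) {β ε₀ ε₁ : ℝ} (R : ℝ) (hb : 6 * |β| < 1 / 2)
    (hρ : 18 * |β| * exp ε₀ / (1 / 2 - 6 * |β|) + exp (ε₀ / 2) * ε₁ / Real.sqrt ((N : ℝ) * (1 / 2 - 6 * |β|)) < 1) :
    MassGapOnBallZd 4 N β ε₀ ε₁ R := by
  have h6 : |β| * (2 * (((4 : ℕ) : ℝ) - 1)) = 6 * |β| := by simp only [Nat.cast_ofNat]; ring
  refine suN_massGapOnBallZd_bakryEmery (d := 4) (by norm_num) hN R (by rw [h6]; exact hb) ?_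
  rw [h6]
  calc 6 * (((4 : ℕ) : ℝ) - 1) * |β| * exp ε₀ / (1 / 2 - 6 * |β|) + exp (ε₀ / 2) * ε₁ / Real.sqrt ((N : ℝ) * (1 / 2 - 6 * |β|))
      = 18 * |β| * exp ε₀ / (1 / 2 - 6 * |β|) + exp (ε₀ / 2) * ε₁ / Real.sqrt ((N : ℝ) * (1 / 2 - 6 * |β|)) := by
        simp only [Nat.cast_ofNat]; ring
    _ < 1 := hρ

/-- **A numeric all-`N` row, `d = 4`**: `(β, ε₀, ε₁) = (1/64, 1/10, 1/10)` ('t Hooft `β = 1/64`, i.e. three quarters of the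
Shen–Zhu–Zhu window `1/48`), every `N ≥ 2` and every range `R`: `MassGapOnBallZd 4 N (1/64) (1/10) (1/10) R`.
Certificate: `1/2 − 6/64 = 13/32`; `18/64 · e^{1/10} · 32/13 ≤ 0.28125·1.1053·2.4616 < 0.766`; `e^{1/20}/(10√(N·13/32)) ≤
1.0513/(10·0.9) < 0.117` for `N ≥ 2`; sum `< 0.883 < 1` (exact rationals, `Real.exp_bound`). [folklore] -/
theorem suN_massGapOnBallZd_bakryEmery_dim4_row (hN : 2 ≤ N) (R : ℝ) :
    MassGapOnBallZd 4 N (1 / 64) (1 / 10) (1 / 10) R := by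
  have hN2 : (2 : ℝ) ≤ N := by exact_mod_cast hN
  have habs : |(1 / 64 : ℝ)| = 1 / 64 := abs_of_pos (by norm_num)
  refine suN_massGapOnBallZd_bakryEmery_dim4 hN R (by rw [habs]; norm_num) ?_
  rw [habs]
  -- exponential bounds
  have he1 : exp (1 / 10 : ℝ) ≤ 1.1053 := by
    have h := Real.exp_bound (x := (1 / 10 : ℝ)) (by rw [abs_of_pos (by norm_num)]; norm_num) (n := 3) (by norm_num)
    have habs' : |(1 / 10 : ℝ)| = 1 / 10 := abs_of_pos (by norm_num)
    simp only [Finset.sum_range_succ, Finset.sum_range_zero, Nat.factorial, habs'] at h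
    norm_num at h
    have := (abs_sub_le_iff.1 h).1
    linarith
  have he2 : exp ((1 / 10 : ℝ) / 2) ≤ 1.0513 := by
    have h := Real.exp_bound (x := (1 / 20 : ℝ)) (by rw [abs_of_pos (by norm_num)]; norm_num) (n := 3) (by norm_num)
    have habs' : |(1 / 20 : ℝ)| = 1 / 20 := abs_of_pos (by norm_num)
    simp only [Finset.sum_range_succ, Finset.sum_range_zero, Nat.factorial, habs'] at h
    norm_num at h
    have := (abs_sub_le_iff.1 h).1
    rw [show (1 / 10 : ℝ) / 2 = 1 / 20 by norm_num]
    linarith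
  -- the square root: √(N · 13/32) ≥ √(13/16) ≥ 0.9
  have hs : (0.9 : ℝ) ≤ Real.sqrt ((N : ℝ) * (1 / 2 - 6 * (1 / 64))) := by
    rw [show (1 / 2 - 6 * (1 / 64) : ℝ) = 13 / 32 by norm_num]
    have h1 : (0.81 : ℝ) ≤ (N : ℝ) * (13 / 32) := by nlinarith
    calc (0.9 : ℝ) = Real.sqrt (0.81) := by rw [show (0.81 : ℝ) = 0.9 ^ 2 by norm_num, Real.sqrt_sq (by norm_num)]
      _ ≤ Real.sqrt ((N : ℝ) * (13 / 32)) := Real.sqrt_le_sqrt h1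
  have hs0 : 0 < Real.sqrt ((N : ℝ) * (1 / 2 - 6 * (1 / 64))) := lt_of_lt_of_le (by norm_num) hs
  have hA : 18 * (1 / 64) * exp (1 / 10 : ℝ) / (1 / 2 - 6 * (1 / 64)) ≤ 0.766 := by
    rw [show (1 / 2 - 6 * (1 / 64) : ℝ) = 13 / 32 by norm_num, div_le_iff₀ (by norm_num)]
    nlinarith [Real.exp_pos (1 / 10 : ℝ)]
  have hB : exp ((1 / 10 : ℝ) / 2) * (1 / 10) / Real.sqrt ((N : ℝ) * (1 / 2 - 6 * (1 / 64))) ≤ 0.117 := by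
    rw [div_le_iff₀ hs0]
    nlinarith [Real.exp_pos ((1 / 10 : ℝ) / 2)]
  linarith

/-! ### 2. The Kantorovich–Rubinstein door with the tree's best all-`N` analytic modulus -/

/-- **ALL `N ≥ 2`, EVERY `d ≥ 1` — MASS GAP OF A MEMBER THROUGH THE KR DOOR with the modulus
`K = min(1/(1/2−b), (N²/(N²−1))(1/2+2b)/(1/2−b))`** (`OneLinkEigen.oneLinkKRModulus_min`; `b = 2(d−1)|β| < 1/2`): for a link
potential `W` with continuous own-link terms supported by `supp` (range `R`) and loads — oscillation `≤ a`, SELF-Lipschitz `≤ ℓ_s`,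
cross-Lipschitz `≤ Λ` — the door condition `6(d−1)|β|·K·e^{a}(1 + 2√N ℓ_s) + √N Λ < 1` gives `PerturbedMassGapAt d N β W supp`.
At zero loads and `d = 4` this is 't Hooft `x·18·min(K_BE, K₁)(6x) < 1` (`x < 0.0246…` as `N → ∞`; Bakry–Émery alone `1/48`).
[folklore] -/
theorem suN_perturbedMassGapAt_eigen (hd : 1 ≤ d) (hN : 2 ≤ N) {β a ℓs Λ R : ℝ} (hℓs : 0 ≤ ℓs)
    (hb : |β| * (2 * ((d : ℝ) - 1)) < 1 / 2)
    {W : Potential (ZdEdge d) (Matrix.specialUnitaryGroup (Fin N) ℂ)} (hWc : ∀ X, Continuous (W X))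
    (hWdep : ∀ X, DependsOn (W X) (↑X : Set (ZdEdge d)))
    {supp : Finset (ZdEdge d) → Finset (Finset (ZdEdge d))} (hsupp : W.IsSupportedBy supp)
    {osc : Finset (ZdEdge d) → ZdEdge d → ℝ} (hosc : ∀ X, Dobrushin.IsOscBound (W X) (osc X))
    (hosca : ∀ e, ∑ X ∈ (supp {e}).filter (fun X => e ∈ X), osc X e ≤ a)
    {lip : Finset (ZdEdge d) → ZdEdge d → ℝ} (hlip : ∀ X, IsLipBound suFrobDist (W X) (lip X))
    (hlips : ∀ e, ∑ X ∈ (supp {e}).filter (fun X => e ∈ X), lip X e ≤ ℓs)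
    (hΛ : ∀ e, ∑ y ∈ perturbedNbr supp e, ∑ X ∈ (supp {e}).filter (fun X => e ∈ X), lip X y ≤ Λ)
    (hR : ∀ e, ∀ X ∈ supp {e}, e ∈ X → ∀ y ∈ X, ‖e.1 - y.1‖ ≤ R)
    (hρ : 6 * ((d : ℝ) - 1) * |β| *
        (min (1 / (1 / 2 - |β| * (2 * ((d : ℝ) - 1))))
            ((N : ℝ) ^ 2 / ((N : ℝ) ^ 2 - 1) * ((1 / 2 + 2 * (|β| * (2 * ((d : ℝ) - 1)))) / (1 / 2 - |β| * (2 * ((d : ℝ) - 1)))))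
          * exp a * (1 + 2 * Real.sqrt N * ℓs)) + Real.sqrt N * Λ < 1) :
    PerturbedMassGapAt d N β W supp := by
  set b : ℝ := |β| * (2 * ((d : ℝ) - 1)) with hbdef
  have hgap : 0 < 1 / 2 - b := by linarith
  have hN2 : (2 : ℝ) ≤ N := by exact_mod_cast hN
  have hN1 : (0 : ℝ) < (N : ℝ) ^ 2 - 1 := by nlinarith
  have hd1 : (1 : ℝ) ≤ d := by exact_mod_cast hd
  have hb0 : 0 ≤ b := mul_nonneg (abs_nonneg _) (by linarith)
  have hK : 0 ≤ min (1 / (1 / 2 - b)) ((N : ℝ) ^ 2 / ((N : ℝ) ^ 2 - 1) * ((1 / 2 + 2 * b) / (1 / 2 - b))) :=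
    le_min (by positivity) (by positivity)
  exact perturbedMassGapAt_of_oneLinkKRModulus hd (by omega) hK hℓs le_rfl (OneLinkEigen.oneLinkKRModulus_min hN hb)
    hWc hWdep hsupp hosc hosca hlip hlips hΛ hR hρ

end Summit.Ventures.YMGap.RobustBallSUN
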